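import Summits.MatrixMultiplication.MatrixMultiplication.Theorems.SoloInformedFamilyWindow
import Summits.MatrixMultiplication.MatrixMultiplication.Theorems.SoloInformedCwTwoPattern
import Literature.Computability.AlgebraicComplexity.BorderRankRestriction
import Literature.Computability.AlgebraicComplexity.BorderRankCW

/-!
# The symmetric stratum of the carrier family is `T_{cw,2}` up to restriction both ways

Solo deliverable (informed mode), closing the description of the family `T_{1,1,M}`
(`SoloInformedCarrierFamily` … `SoloInformedFamilyWindow`): for every non-degenerate SYMMETRIC
block `M′` there are restrictions `T_{1,1,M} ≥ T_{cw,2}` and `T_{cw,2} ≥ T_{1,1,M}`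
(`symmBlock_equiv_cwTensor_two`; no classification — a shear diagonalises `M′`, two square roots
scale it to `I`, the degenerate corner cases are moved by a lower shear or a swap, and every move is
undone by a move of the same kind: `shear_restrictsTo`, `lshear_restrictsTo`, `swap_restrictsTo`).

Consequences: on the symmetric stratum every restriction-monotone invariant takes its `T_{cw,2}`
value — `asymptoticRank_symmBlock_eq`, `algBorderRank_symmBlock_eq`, `tensorRank_symmBlock_eq`,
hence `R = R̲ = 4` given CGLV's `R̲(T_{cw,q}) = q + 2` (`rank_symmBlock_eq_four`) — and
`symmBlock_door_iff`: **the door of a symmetric member IS the `T_{cw,2}` door**, while off the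
stratum (`R̲ = 5`, `five_le_algBorderRank_cwShape`) the doors are those of the `H(μ)` / `Γ₂`
carriers.
-/

noncomputable section

open scoped BigOperators
open Literature.Computability.AlgebraicComplexity

namespace Summit.MatrixMultiplication.MatrixMultiplication.Theorems.CarrierFamily

/-! ## The symmetric stratum is the Coppersmith–Winograd tensor, up to restriction both ways -/

/-- Entries of the scaled block. [folklore] -/
theorem scaleBlock_entries (s t : ℂ) (M : Matrix (Fin 3) (Fin 3) ℂ) :
    scaleBlock s t M 1 1 = s ^ 2 * M 1 1 ∧ scaleBlock s t M 1 2 = s * t * M 1 2 ∧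
      scaleBlock s t M 2 1 = s * t * M 2 1 ∧ scaleBlock s t M 2 2 = t ^ 2 * M 2 2 := by
  simp [scaleBlock]

/-- Undoing a shear: `T_{1,1,XᵀMX} ≥ T_{1,1,M}`. [folklore] -/
theorem shear_restrictsTo (M : Matrix (Fin 3) (Fin 3) ℂ) (x : ℂ) :
    TensorRestrictsTo (cwShapeTensor 1 1 (shearBlock x M)) (cwShapeTensor 1 1 M) := by
  have h := cwShapeTensor_restrictsTo_shear (shearBlock x M) (-x)
  rwa [cwShapeTensor_one_one_congr (M := shearBlock (-x) (shearBlock x M)) (N := M)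
    (by simp [shearBlock]) (by simp [shearBlock]) (by simp [shearBlock])
    (by simp [shearBlock]; ring)] at h

/-- Undoing a lower shear: `T_{1,1,X′ᵀMX′} ≥ T_{1,1,M}`. [folklore] -/
theorem lshear_restrictsTo (M : Matrix (Fin 3) (Fin 3) ℂ) (t : ℂ) :
    TensorRestrictsTo (cwShapeTensor 1 1 (lshearBlock t M)) (cwShapeTensor 1 1 M) := by
  have h := cwShapeTensor_restrictsTo_lshear (lshearBlock t M) (-t)
  rwa [cwShapeTensor_one_one_congr (M := lshearBlock (-t) (lshearBlock t M)) (N := M)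
    (by simp [lshearBlock]; ring) (by simp [lshearBlock]) (by simp [lshearBlock])
    (by simp [lshearBlock])] at h

/-- Undoing a swap: `T_{1,1,JMJ} ≥ T_{1,1,M}`. [folklore] -/
theorem swap_restrictsTo (M : Matrix (Fin 3) (Fin 3) ℂ) :
    TensorRestrictsTo (cwShapeTensor 1 1 (swapBlock M)) (cwShapeTensor 1 1 M) := by
  have h := cwShapeTensor_restrictsTo_swap (swapBlock M)
  rwa [cwShapeTensor_one_one_congr (M := swapBlock (swapBlock M)) (N := M)
    (by simp [swapBlock]) (by simp [swapBlock]) (by simp [swapBlock]) (by simp [swapBlock])] at h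

/-- Symmetric stratum, main case `M′₁₁ ≠ 0`: **`T_{1,1,M} ≥ T_{cw,2}` and `T_{cw,2} ≥ T_{1,1,M}`**
(shear-diagonalise, then scale by two square roots). [cite: CoppersmithWinograd1990, §6] -/
theorem symmBlock_equiv_cwTensor_two_of_ne {M : Matrix (Fin 3) (Fin 3) ℂ}
    (hdet : (innerBlock M).det ≠ 0) (hsym : M 1 2 = M 2 1) (h11 : M 1 1 ≠ 0) :
    TensorRestrictsTo (cwShapeTensor 1 1 M) (cwTensor ℂ 2) ∧
      TensorRestrictsTo (cwTensor ℂ 2) (cwShapeTensor 1 1 M) := by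
  rw [det_innerBlock] at hdet
  set x : ℂ := -(M 1 2) * (M 1 1)⁻¹ with hx_def
  have hx : x * M 1 1 = -(M 1 2) := by rw [hx_def]; exact inv_mul_cancel_right₀ h11 _
  have hd' : M 1 1 * x ^ 2 + (M 1 2 + M 2 1) * x + M 2 2 ≠ 0 := by
    intro h
    apply hdet
    have e : M 1 1 * (M 1 1 * x ^ 2 + (M 1 2 + M 2 1) * x + M 2 2) =
        M 1 1 * M 2 2 - M 1 2 * M 2 1 := by linear_combination (x * M 1 1 + M 2 1) * hx
    rw [← e, h, mul_zero]
  obtain ⟨w, hw⟩ := IsAlgClosed.exists_eq_mul_self (M 1 1)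
  obtain ⟨z, hz⟩ := IsAlgClosed.exists_eq_mul_self (M 1 1 * x ^ 2 + (M 1 2 + M 2 1) * x + M 2 2)
  have hw0 : w ≠ 0 := by rintro rfl; exact h11 (by rw [hw, mul_zero])
  have hz0 : z ≠ 0 := by rintro rfl; exact hd' (by rw [hz, mul_zero])
  obtain ⟨e11, e12, e21, e22⟩ := shearBlock_entries x M
  have n12 : shearBlock x M 1 2 = 0 := by rw [e12]; linear_combination hx
  have n21 : shearBlock x M 2 1 = 0 := by rw [e21]; linear_combination hx - hsym
  rw [← cwShapeTensor_one_one_one]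
  constructor
  · -- forward: `T_M ≥ T_N ≥ T_{scale(w⁻¹,z⁻¹) N} = T_1`
    have hres := cwShapeTensor_restrictsTo_scale (shearBlock x M) (s := w⁻¹) (t := z⁻¹) (u := w)
      (v := z) (mul_inv_cancel₀ hw0) (mul_inv_cancel₀ hz0)
    obtain ⟨s11, s12, s21, s22⟩ := scaleBlock_entries w⁻¹ z⁻¹ (shearBlock x M)
    rw [cwShapeTensor_one_one_congr (M := scaleBlock w⁻¹ z⁻¹ (shearBlock x M))
      (N := (1 : Matrix (Fin 3) (Fin 3) ℂ))
      (by rw [s11, e11, hw, Matrix.one_apply_eq]; field_simp)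
      (by rw [s12, n12, mul_zero, Matrix.one_apply_ne (by decide)])
      (by rw [s21, n21, mul_zero, Matrix.one_apply_ne (by decide)])
      (by rw [s22, e22, hz, Matrix.one_apply_eq]; field_simp)] at hres
    exact (cwShapeTensor_restrictsTo_shear M x).trans hres
  · -- backward: `T_1 ≥ T_{scale(w,z) 1} = T_N ≥ T_M`
    have hres := cwShapeTensor_restrictsTo_scale (1 : Matrix (Fin 3) (Fin 3) ℂ) (s := w) (t := z)
      (u := w⁻¹) (v := z⁻¹) (inv_mul_cancel₀ hw0) (inv_mul_cancel₀ hz0)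
    rw [cwShapeTensor_one_one_congr (M := scaleBlock w z 1) (N := shearBlock x M)
      (by simp [scaleBlock, shearBlock]; linear_combination (-1 : ℂ) * hw)
      (by simp [scaleBlock, shearBlock]; linear_combination (-1 : ℂ) * hx)
      (by simp [scaleBlock, shearBlock]; linear_combination (-1 : ℂ) * hx + hsym)
      (by simp [scaleBlock, shearBlock]; linear_combination (-1 : ℂ) * hz)] at hres
    exact hres.trans (shear_restrictsTo M x)

/-- **The symmetric stratum is restriction-equivalent to `T_{cw,2}`**: for every non-degenerate
symmetric `M′`, `T_{1,1,M} ≥ T_{cw,2}` and `T_{cw,2} ≥ T_{1,1,M}` (no classification: shears, a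
swap, two square roots). [cite: CoppersmithWinograd1990, §6] -/
theorem symmBlock_equiv_cwTensor_two {M : Matrix (Fin 3) (Fin 3) ℂ}
    (hdet : (innerBlock M).det ≠ 0) (hsym : M 1 2 = M 2 1) :
    TensorRestrictsTo (cwShapeTensor 1 1 M) (cwTensor ℂ 2) ∧
      TensorRestrictsTo (cwTensor ℂ 2) (cwShapeTensor 1 1 M) := by
  by_cases h11 : M 1 1 = 0
  swap
  · exact symmBlock_equiv_cwTensor_two_of_ne hdet hsym h11
  rw [det_innerBlock] at hdet
  have h12 : M 1 2 ≠ 0 := by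
    intro h; apply hdet; rw [h11, h]; ring
  by_cases h22 : M 2 2 = 0
  · have l11 : lshearBlock 1 M 1 1 = M 1 1 + (M 1 2 + M 2 1) * 1 + M 2 2 * 1 ^ 2 := by
      simp [lshearBlock]
    have l12 : lshearBlock 1 M 1 2 = M 1 2 + M 2 2 * 1 := by simp [lshearBlock]
    have l21 : lshearBlock 1 M 2 1 = M 2 1 + M 2 2 * 1 := by simp [lshearBlock]
    have l22 : lshearBlock 1 M 2 2 = M 2 2 := by simp [lshearBlock]
    have hdet' : (innerBlock (lshearBlock 1 M)).det ≠ 0 := by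
      rw [det_innerBlock, l11, l12, l21, l22, h11, h22]
      intro h; apply hdet; rw [h11, h22]; linear_combination h
    have hsym' : lshearBlock 1 M 1 2 = lshearBlock 1 M 2 1 := by rw [l12, l21, hsym]
    have h11' : lshearBlock 1 M 1 1 ≠ 0 := by
      rw [l11, h11, h22]
      intro h; apply h12; linear_combination h / 2 + hsym / 2
    obtain ⟨hf, hb⟩ := symmBlock_equiv_cwTensor_two_of_ne hdet' hsym' h11'
    exact ⟨(cwShapeTensor_restrictsTo_lshear M 1).trans hf, hb.trans (lshear_restrictsTo M 1)⟩
  · have s11 : swapBlock M 1 1 = M 2 2 := by simp [swapBlock]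
    have s12 : swapBlock M 1 2 = M 2 1 := by simp [swapBlock]
    have s21 : swapBlock M 2 1 = M 1 2 := by simp [swapBlock]
    have s22 : swapBlock M 2 2 = M 1 1 := by simp [swapBlock]
    have hdet' : (innerBlock (swapBlock M)).det ≠ 0 := by
      rw [det_innerBlock, s11, s12, s21, s22]
      intro h; apply hdet; linear_combination h
    have hsym' : swapBlock M 1 2 = swapBlock M 2 1 := by rw [s12, s21, hsym]
    have h11' : swapBlock M 1 1 ≠ 0 := by rw [s11]; exact h22
    obtain ⟨hf, hb⟩ := symmBlock_equiv_cwTensor_two_of_ne hdet' hsym' h11'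
    exact ⟨(cwShapeTensor_restrictsTo_swap M).trans hf, hb.trans (swap_restrictsTo M)⟩

/-- Hence **on the symmetric stratum every restriction-monotone invariant equals its value at
`T_{cw,2}`**: asymptotic rank … [cite: BurgisserClausenShokrollahi1997, Lemma (15.27)] -/
theorem asymptoticRank_symmBlock_eq {M : Matrix (Fin 3) (Fin 3) ℂ}
    (hdet : (innerBlock M).det ≠ 0) (hsym : M 1 2 = M 2 1) :
    asymptoticRank (cwShapeTensor 1 1 M) = asymptoticRank (cwTensor ℂ 2) := by
  obtain ⟨hf, hb⟩ := symmBlock_equiv_cwTensor_two hdet hsym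
  exact le_antisymm (asymptoticRank_le_of_algDegeneratesTo hb.algDegeneratesTo)
    (asymptoticRank_le_of_algDegeneratesTo hf.algDegeneratesTo)

/-- … border rank … [cite: ConnerGesmundoLandsbergVentura2022, §1.1] -/
theorem algBorderRank_symmBlock_eq {M : Matrix (Fin 3) (Fin 3) ℂ}
    (hdet : (innerBlock M).det ≠ 0) (hsym : M 1 2 = M 2 1) :
    algBorderRank (cwShapeTensor 1 1 M) = algBorderRank (cwTensor ℂ 2) := by
  obtain ⟨hf, hb⟩ := symmBlock_equiv_cwTensor_two hdet hsym
  exact le_antisymm hb.algBorderRank_le hf.algBorderRank_le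

/-- … and rank. [folklore] -/
theorem tensorRank_symmBlock_eq {M : Matrix (Fin 3) (Fin 3) ℂ}
    (hdet : (innerBlock M).det ≠ 0) (hsym : M 1 2 = M 2 1) :
    tensorRank (cwShapeTensor 1 1 M) = tensorRank (cwTensor ℂ 2) := by
  obtain ⟨hf, hb⟩ := symmBlock_equiv_cwTensor_two hdet hsym
  exact le_antisymm hb.tensorRank_le hf.tensorRank_le

/-- With CGLV's `R̲(T_{cw,2}) = 4` (named fact): **the symmetric stratum has `R = R̲ = 4`**, the
non-symmetric stratum `R = R̲ = 5` (`five_le_algBorderRank_cwShape`,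
`tensorRank_blockNormal_le_five`). [cite: ConnerGesmundoLandsbergVentura2022, Thm. 1.2] -/
theorem rank_symmBlock_eq_four (h : CGLV2022_borderRank_cwTensor) {M : Matrix (Fin 3) (Fin 3) ℂ}
    (hdet : (innerBlock M).det ≠ 0) (hsym : M 1 2 = M 2 1) :
    algBorderRank (cwShapeTensor 1 1 M) = 4 ∧ tensorRank (cwShapeTensor 1 1 M) = 4 := by
  rw [algBorderRank_symmBlock_eq hdet hsym, tensorRank_symmBlock_eq hdet hsym]
  exact ⟨h 2 le_rfl, tensorRank_cwTensor_two_eq_four h⟩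

/-- **The symmetric stratum carries literally the `T_{cw,2}` door**: `R̃(T_{1,1,M}) ≤ 3 ↔
R̃(T_{cw,2}) ≤ 3` for symmetric non-degenerate `M′`; off the stratum the doors are those of the
`H(μ)` / `Γ₂` carriers, which no degeneration is known to relate to `T_{cw,2}`. [folklore] -/
theorem symmBlock_door_iff {M : Matrix (Fin 3) (Fin 3) ℂ}
    (hdet : (innerBlock M).det ≠ 0) (hsym : M 1 2 = M 2 1) :
    asymptoticRank (cwShapeTensor 1 1 M) ≤ 3 ↔ asymptoticRank (cwTensor ℂ 2) ≤ 3 := by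
  rw [asymptoticRank_symmBlock_eq hdet hsym]

end Summit.MatrixMultiplication.MatrixMultiplication.Theorems.CarrierFamily

end
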